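import Summits.BirchSwinnertonDyer.BirchSwinnertonDyer.Theorems.KolyvaginRankRigidityAtTwoSwapAuxClassFamilyAtTwo
import Summits.BirchSwinnertonDyer.BirchSwinnertonDyer.Theorems.KolyvaginRankRigidityAtTwoSwapPairingUpperBoundFamilyAtTwo
import Summits.BirchSwinnertonDyer.BirchSwinnertonDyer.Theorems.ClassRecordThreeEulerHalvesAtThreeWalkSupplyTransverse
import HarnessLib

/-!
# Crux V2♭θ `KolyvaginCorankLowerBoundAtTwoTheta` (stmt-BirchSwinnertonDyer-27220), line
# `kolyvagin_depth_split`, inside of S1: P5 and P7b for the GLOBAL intrinsic transverse family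
# (conductor-independent `𝒯`, the family of the P4 file `…TransverseClassAtTwo`; helper, PROVED; seat `bsd-line-krr2-p2` g7)

The S1 composition quantifies ONE transverse structure per level, independent of the conductor: the global
intrinsic family `𝒯_v = ⨅_{ℓ prime, ℓ ∈ v} ⨅_{w' ∣ v} ker(H¹(K_v, E[2^M]) → H¹(K[ℓ]_{w'}, E[2^M]))`
(`JET.Walk.exists_globalTransverseFamily`; P4 is landed for it in `…TransverseClassAtTwo`).  At the places of a
square-free conductor `c` it AGREES with the per-conductor family (`JET.Walk.globalTransverse_eq_of_mem_placesDividing`),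
so this seat's per-conductor discharges transfer verbatim:
* `pow_smul_localTatePairingZMod_eq_zero_of_globalTransverseFamily_two` — `hP7b` (`c₇' = 0`);
* `exists_auxClass_large_of_globalTransverseFamily_two` — `hP5` (`c₅ = 5`, `M ≥ 9`; `𝓕(m)` built from the global
  family equals `𝓕(m)` built from the `m`-family, `selmerF` reading `𝒯` only at the places of `m`).
HONEST FRAMING: helper (`--supports` 27220); S1 / V2♭θ are NOT proved; BSD is not proved by any of this.

References: [cite: Kolyvagin1991MathAnn, §2 (proof of Thm. 2.2)] [cite: Jetchev2008, §3.1.2 (p. 814), §5 Thm. 5.1]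
[cite: McCallumLMS1991, §5 Prop. 5.2].
-/

set_option autoImplicit false
set_option linter.dupNamespace false

noncomputable section

open scoped Classical
open Function NumberField IsDedekindDomain WeierstrassCurve Field
open Literature.NumberTheory.EllipticCurves Literature.NumberTheory.EllipticCurves.Jetchev2008
open Literature.NumberTheory.GaloisRepresentations Literature.NumberTheory.GaloisCohomology
open Literature.NumberTheory.GaloisRepresentations.DiscreteGaloisModule (localTatePairingZMod tateDual
  transverseSubgroup SelmerStructure)
open Literature.NumberTheory.Automorphic
open Summit.BirchSwinnertonDyer.Rank1Residual
open Summit.BirchSwinnertonDyer.Rank1Residual.JET.SelmerVocabulary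
open Summit.BirchSwinnertonDyer.Rank1Residual.JET.GlobalDuality

namespace Summit.BirchSwinnertonDyer.BirchSwinnertonDyer.Theorems.KolyvaginLowerBoundAtTwo

variable (W : WeierstrassCurve ℚ) [W.IsElliptic] [W.IsGloballyMinimal] (K : Type) [Field K] [NumberField K]
  (ι : K →+* ℂ) [∀ j : ℕ, NumberField (ringClassField K ι j)] (M : ℕ)
  {𝒯 : SelmerStructure ((W.baseChange K).torsionGaloisModule ((2 ^ M : ℕ) : ℤ))}
  (h𝒯 : ∀ v : HeightOneSpectrum (𝓞 K), 𝒯 (Sum.inr v) =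
    ⨅ (ℓ : ℕ) (_ : ℓ.Prime ∧ (ℓ : 𝓞 K) ∈ v.asIdeal),
      ⨅ (w' : HeightOneSpectrum (𝓞 (ringClassField K ι ℓ)))
        (_ : w'.asIdeal.LiesOver v.asIdeal),
        letI := (adicCompletionOfLiesOver K (ringClassField K ι ℓ) v w').toAlgebra
        transverseSubgroup (GaloisRep.toLocal v ((W.baseChange K).torsionGaloisModule ((2 ^ M : ℕ) : ℤ)))
          (w'.adicCompletion (ringClassField K ι ℓ)))

omit [W.IsElliptic] [W.IsGloballyMinimal] in
include h𝒯 in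
/-- `𝓕(m)` built from the global family equals `𝓕(m)` built from the per-conductor family of `m`
(`selmerF` reads `𝒯` only at the places of `m`, where the two agree). [cite: Jetchev2008, §3.1.2 (p. 814)] -/
theorem selmerF_globalTransverse_eq {m : ℕ} (hm : Squarefree m)
    {𝒯c : SelmerStructure ((W.baseChange K).torsionGaloisModule ((2 ^ M : ℕ) : ℤ))}
    (h𝒯c : ∀ v : HeightOneSpectrum (𝓞 K), 𝒯c (Sum.inr v) =
      ⨅ ℓ ∈ m.primeFactors.filter (fun ℓ : ℕ ↦ ((ℓ : ℕ) : 𝓞 K) ∈ v.asIdeal),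
        ⨅ (w' : HeightOneSpectrum (𝓞 (ringClassField K ι ℓ))) (_ : w'.asIdeal.LiesOver v.asIdeal),
          letI := (adicCompletionOfLiesOver K (ringClassField K ι ℓ) v w').toAlgebra
          transverseSubgroup (GaloisRep.toLocal v ((W.baseChange K).torsionGaloisModule ((2 ^ M : ℕ) : ℤ)))
            (w'.adicCompletion (ringClassField K ι ℓ))) :
    selmerF W ((2 ^ M : ℕ) : ℤ) 𝒯 (placesDividing K m) = selmerF W ((2 ^ M : ℕ) : ℤ) 𝒯c (placesDividing K m) := by
  funext v
  rcases v with u | v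
  · simp [selmerF, SelmerStructure.transverseAt, SelmerStructure.modify_inl]
  · rw [selmerF_inr, selmerF_inr]
    by_cases hv : v ∈ placesDividing K m
    · rw [if_pos hv, if_pos hv, JET.Walk.globalTransverse_eq_of_mem_placesDividing h𝒯 hm h𝒯c v hv]
    · rw [if_neg hv, if_neg hv]

include h𝒯 in
/-- **`hP7b` for the global intrinsic transverse family at `2`** (constant `0`): transfer of
`pow_smul_localTatePairingZMod_eq_zero_of_localTransverseFamily_two` along the agreement of the two families at
the places of `c`. [cite: Kolyvagin1991MathAnn, §2 (proof of Thm. 2.2)] [cite: Jetchev2008, §3.1.2, §4.2] -/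
theorem pow_smul_localTatePairingZMod_eq_zero_of_globalTransverseFamily_two (hK : IsImaginaryQuadratic K)
    (hD : NumberField.discr K < -4) (hM : 1 ≤ M) [NeZero (2 ^ M)]
    [Finite (geomTorsion (W.baseChange K) ((2 ^ M : ℕ) : ℤ))]
    (c : ℕ) (hc : Squarefree c)
    (hkol : ∀ ℓ ∈ c.primeFactors, Zhang2014.IsKolyvaginPrime (W.conductorNorm ℤ) W K 2 ℓ)
    (hkM : ∀ ℓ ∈ c.primeFactors, M + 1 ≤ Zhang2014.kolyvaginIndex W 2 ℓ)
    (e : geomTorsion (W.baseChange K) ((2 ^ M : ℕ) : ℤ) → geomTorsion (W.baseChange K) ((2 ^ M : ℕ) : ℤ) →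
      AlgebraicClosure K)
    (hμ : ∀ S T, e S T ^ (2 ^ M) = 1)
    (hadd₁ : ∀ S₁ S₂ T, e (S₁ + S₂) T = e S₁ T * e S₂ T)
    (hadd₂ : ∀ S T₁ T₂, e S (T₁ + T₂) = e S T₁ * e S T₂)
    (hgal : ∀ (g : absoluteGaloisGroup K) (S T : geomTorsion (W.baseChange K) ((2 ^ M : ℕ) : ℤ)),
      g • e S T = e (g • S) (g • T))
    (halt : ∀ T, e T T = 1) (hnondeg : ∀ T, (∀ S, e S T = 1) → T = 0)
    (inv : LocalInvariants K (2 ^ M)) (hperf : inv.IsPerfect)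
    (v : HeightOneSpectrum (𝓞 K)) (hvc : v ∈ placesDividing K c)
    (w C : galoisCohomology ((W.baseChange K).torsionGaloisModule ((2 ^ M : ℕ) : ℤ)) 1) {a₀ b₀ : ℕ}
    (hCT : galoisCohomology.localization ((W.baseChange K).torsionGaloisModule ((2 ^ M : ℕ) : ℤ)) (Sum.inr v) 1 C ∈
      𝒯 (Sum.inr v))
    (hwT : ((2 ^ a₀ : ℕ) : ℤ) •
      galoisCohomology.localization ((W.baseChange K).torsionGaloisModule ((2 ^ M : ℕ) : ℤ)) (Sum.inr v) 1 w ∈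
        𝒯 (Sum.inr v))
    (hC0 : ((2 ^ b₀ : ℕ) : ℤ) •
      galoisCohomology.localization ((W.baseChange K).torsionGaloisModule ((2 ^ M : ℕ) : ℤ)) (Sum.inr v) 1 C = 0) :
    (2 ^ (a₀ + b₀ - M) : ℕ) •
        localTatePairingZMod ((W.baseChange K).torsionGaloisModule ((2 ^ M : ℕ) : ℤ)) (2 ^ M) (Sum.inr v)
          (inv (Sum.inr v))
          (galoisCohomology.localization ((W.baseChange K).torsionGaloisModule ((2 ^ M : ℕ) : ℤ)) (Sum.inr v) 1 w)
          (galoisCohomology.localization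
            (((W.baseChange K).torsionGaloisModule ((2 ^ M : ℕ) : ℤ)).tateDual (2 ^ M)) (Sum.inr v) 1
            (galoisCohomology.map
              (weilDualIntertwining (W.baseChange K) (2 ^ M) e hμ hadd₁ hadd₂ hgal) 1 C)) = 0 := by
  obtain ⟨𝒯c, h𝒯c, -⟩ := JET.exists_localTransverseFamily W ι (((2 ^ M : ℕ) : ℤ)) hc.ne_zero
  have heq : 𝒯 (Sum.inr v) = 𝒯c (Sum.inr v) := JET.Walk.globalTransverse_eq_of_mem_placesDividing h𝒯 hc h𝒯c v hvc
  rw [heq] at hCT hwT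
  exact pow_smul_localTatePairingZMod_eq_zero_of_localTransverseFamily_two W K hK hD ι M hM c hc hkol hkM 𝒯c h𝒯c e
    hμ hadd₁ hadd₂ hgal halt hnondeg inv hperf v hvc w C hCT hwT hC0

include h𝒯 in
/-- **`hP5` for the global intrinsic transverse family at `2`** (`c₅ = 5`, `M ≥ 9`): transfer of
`exists_auxClass_large_of_localTransverseFamily_two` (`𝓕(m)` is the same structure for both families).
[cite: Kolyvagin1991MathAnn, §2 (proof of Thm. 2.2)] [cite: McCallumLMS1991, §5 Prop. 5.2] [cite: Jetchev2008, §5 Thm. 5.1] -/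
theorem exists_auxClass_large_of_globalTransverseFamily_two (hK : IsImaginaryQuadratic K)
    (hD : NumberField.discr K < -4) (τ : K ≃ₐ[ℚ] K) (hτ1 : τ ≠ 1) (hττ : τ * τ = 1)
    (hM : 9 ≤ M) [NeZero (2 ^ M)] [Finite (geomTorsion (W.baseChange K) ((2 ^ M : ℕ) : ℤ))]
    (m : ℕ) (hm : Squarefree m)
    (hkol : ∀ ℓ ∈ m.primeFactors, Zhang2014.IsKolyvaginPrime (W.conductorNorm ℤ) W K 2 ℓ)
    (hkM : ∀ ℓ ∈ m.primeFactors, M + 1 ≤ Zhang2014.kolyvaginIndex W 2 ℓ)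
    (e : geomTorsion (W.baseChange K) ((2 ^ M : ℕ) : ℤ) → geomTorsion (W.baseChange K) ((2 ^ M : ℕ) : ℤ) →
      AlgebraicClosure K)
    (hμ : ∀ S T, e S T ^ (2 ^ M) = 1)
    (hadd₁ : ∀ S₁ S₂ T, e (S₁ + S₂) T = e S₁ T * e S₂ T)
    (hadd₂ : ∀ S T₁ T₂, e S (T₁ + T₂) = e S T₁ * e S T₂)
    (hgal : ∀ (g : absoluteGaloisGroup K) (S T : geomTorsion (W.baseChange K) ((2 ^ M : ℕ) : ℤ)),
      g • e S T = e (g • S) (g • T))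
    (halt : ∀ T, e T T = 1) (hnondeg : ∀ T, (∀ S, e S T = 1) → T = 0)
    (hτe : ∀ S T, liftAut τ (e S T) =
      e ((isLiftOfAut_liftAut τ).torsionMap W ((2 ^ M : ℕ) : ℤ) S)
        ((isLiftOfAut_liftAut τ).torsionMap W ((2 ^ M : ℕ) : ℤ) T))
    (inv : LocalInvariants K (2 ^ M)) (hperf : inv.IsPerfect) (hvan : inv.SumLocalTermEqZero)
    (hSC : inv.SelmerComplement) (hinvc : inv.IsConjCompatible τ)
    {a : ℕ} (ha : Zhang2014.IsKolyvaginPrime (W.conductorNorm ℤ) W K 2 a)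
    (hMa : M + 1 ≤ Zhang2014.kolyvaginIndex W 2 a) (ham : ¬ a ∣ m)
    (v₀ : HeightOneSpectrum (𝓞 K)) (hv₀ : ((a : ℕ) : 𝓞 K) ∈ v₀.asIdeal)
    {s : ℤ} (hs : s = 1 ∨ s = -1) :
    ∃ w : galoisCohomology ((W.baseChange K).torsionGaloisModule ((2 ^ M : ℕ) : ℤ)) 1,
      w ∈ signPart W K τ ((2 ^ M : ℕ) : ℤ) s
        (((selmerF W ((2 ^ M : ℕ) : ℤ) 𝒯 (placesDividing K m)).relaxedAt {v₀}).selmerGroup) ∧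
      ((2 ^ (M / 2 - 5) : ℕ) : ℤ) • w ≠ 0 := by
  obtain ⟨𝒯c, h𝒯c, -⟩ := JET.exists_localTransverseFamily W ι (((2 ^ M : ℕ) : ℤ)) hm.ne_zero
  rw [selmerF_globalTransverse_eq W K ι M h𝒯 hm h𝒯c]
  exact exists_auxClass_large_of_localTransverseFamily_two W K hK hD ι τ hτ1 hττ M hM m hm hkol hkM 𝒯c h𝒯c e hμ
    hadd₁ hadd₂ hgal halt hnondeg hτe inv hperf hvan hSC hinvc ha hMa ham v₀ hv₀ hs

end Summit.BirchSwinnertonDyer.BirchSwinnertonDyer.Theorems.KolyvaginLowerBoundAtTwo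

end
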